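import Literature.MathematicalPhysics.KineticTheory.PrefixRungHostBlock
import Literature.MathematicalPhysics.KineticTheory.CellChainEnergyFlow
import Literature.MathematicalPhysics.KineticTheory.SiteChainHamiltonianFlow
import Literature.MathematicalPhysics.KineticTheory.SiteChainQuarticDissipation
import HarnessLib

/-!
# The cell-block regime of the prefix cell chain: a definite dissipation `≥ ε K³` at the LEFT bath over a window `Λ/K`

Trunk T-KINETIC (Literature/MathematicalPhysics/KineticTheory). For the MIXED rung
`cellChain ω₂ lam β γ (· < k)` on `N = k + 1 + n` sites (crux `PrefixSteadyStates` of
`AtomisticToContinuum/FouriersLaw`; Cuneo–Eckmann–Hairer–Rey-Bellet 2018 §5.1 on the cell block,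
outside their Condition C3 by Rem. 2.11): along the pathwise solution `z = drivenFlow Y x (0, η)` at
energy scale `K⁴` (`H(x) ≤ 2K⁴`, noise `‖η‖ ≤ δ₀K` on `[0, T]`, `A δ₀ K T ≤ K`), if at some time `s₀`
the rescaled limit energy of the CELL BLOCK is at least `ε_c`, then over the window
`[s₀, s₀ + Λ/K]` the smooth left-bath momentum dissipates `∫ ȳ₀² ≥ (ε₁/16) K³`, where `ε₁` is any
uniform lower bound for the left-bath dissipation of the limit cell chain on the energy shell
`[ε_c, c₁ + 1]` over the rescaled window `Λ` (CEHR Prop. 5.14 for the limit cell chain — a displayed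
hypothesis here, proved in the crux as `stub_prefixLimitDissipation`). Ingredients: the cocycle
property of the driven flow (restart at `s₀`), the energy ceiling of `CellChainEnergyFlow.lean`, the
closeness theorem `prefixRung_dissipation_ge_of_limit` (`PrefixRungScaleCloseness.lean`), the
Hamiltonian flow of the limit cell chain (`SiteChainHamiltonianFlow.lean`: existence, energy
conservation) as the reference solution, and the elementary correction for the constant momentum
shift `η₀(s₀)` between the restarted and the original smooth parts.

* `sq_half_sub_le_sq_add` — `(a + e)²/2 - e² ≤ a²`;
* `prefixRung_cellRegime_gain` — the statement above.

## References

* N. Cuneo, J.-P. Eckmann, M. Hairer, L. Rey-Bellet, EJP 23 (2018) no. 55 (arXiv:1712.09413), §5.1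
  (Prop. 5.3, Lemma 5.17, Prop. 5.14), Remark 2.11.
-/

noncomputable section

open MeasureTheory Filter Topology Set Metric Function Finset
open scoped NNReal

namespace Literature.MathematicalPhysics.KineticTheory.HeatConduction

open OscillatorChain Literature.Analysis.ODE Literature.MathematicalPhysics.KineticTheory

/-- `(a + e)²/2 - e² ≤ a²`. [folklore] -/
theorem sq_half_sub_le_sq_add (a e : ℝ) : (a + e) ^ 2 / 2 - e ^ 2 ≤ a ^ 2 := by
  nlinarith [sq_nonneg (a - e), sq_nonneg (a + e - 2 * e)]

section CellGain

/- The limit cell chain of the prefix rung, as a structure literal (notation only, as in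
`PrefixRungScaling.lean`). -/
set_option quotPrecheck false in
local notation "P₀⟦" lam ", " β ", " k "⟧" =>
  (SiteChain.mk (fun i q => (if i < k then lam else 0) * q ^ 4 / 4) (fun _ r => β * r ^ 4 / 4) 0)

variable {ω₂ lam β γ : ℝ} {k n : ℕ}

/-- The noise restarted at `s₀` is the increment path. [folklore] -/
theorem restart_noise_eq {N : ℕ} (η : ℝ → Fin N → ℝ) (s₀ : ℝ) :
    (fun r => (((0 : Fin N → ℝ), η (s₀ + r)) : PhaseSpace N) - ((0 : Fin N → ℝ), η s₀)) =
      fun r => ((0 : Fin N → ℝ), η (s₀ + r) - η s₀) := by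
  funext r; ext i <;> simp

set_option maxHeartbeats 1600000 in
/-- **The cell-block regime gains `(ε₁/16) K³` at the left bath over a window `Λ/K`.** Data: the
prefix rung with `ω₂, lam, β > 0`, `γ ≥ 0`, `0 < k`, on `k + 1 + n` sites; `Λ, δ₀, ε₁ > 0`,
`δ₀ ≤ 1`, any level `ε_c`; the displayed hypothesis `hS5` is CEHR Prop. 5.14 for the limit cell chain on the shell
`[ε_c, c₁ + 1]` over `[0, Λ]` (`c₁ = pinnedChainScaleC`). Then there is `K₀ ≥ 1` such that for
`K ≥ K₀`: for every start `x` with `H(x) ≤ 2K⁴`, every continuous noise path `η` with `‖η‖ ≤ δ₀K` on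
`[0, T]` and `A δ₀ K T ≤ K` (`A = pinnedChainScaleA`), and every `s₀ ≥ 0` with `s₀ + Λ/K ≤ T` at
which `ε_c ≤ Ĥ₀(π(rescale K z(s₀)))`, the smooth left-bath momentum of `z = drivenFlow Y x (0,η)`
satisfies `∫_{s₀}^{s₀+Λ/K} ȳ₀² ≥ (ε₁/16) K³`.
[cite: CuneoEckmannHairerReyBellet2018, Prop 5.3 and Prop 5.14] -/
theorem prefixRung_cellRegime_gain (hω : 0 < ω₂) (hl : 0 < lam) (hβ : 0 < β) (hγ : 0 ≤ γ) (hk : 0 < k)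
    {Λ δ₀ εc ε₁ : ℝ} (hΛ : 0 < Λ) (hδ₀ : 0 < δ₀) (hδ₁ : δ₀ ≤ 1) (hε₁ : 0 < ε₁)
    (hS5 : ∀ (xh : PhaseSpace (k + 1)) (y : ℝ → PhaseSpace (k + 1)),
      εc ≤ P₀⟦lam, β, k⟧.hamiltonian (k + 1) xh →
      P₀⟦lam, β, k⟧.hamiltonian (k + 1) xh ≤ pinnedChainScaleC ω₂ lam β γ (k + 1 + n) + 1 →
      Continuous y → y 0 = xh →
      (∀ t ∈ Ioo 0 Λ, HasDerivAt y (SiteChain.langevinDrift P₀⟦lam, β, k⟧ (k + 1) (y t)) t) →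
      ε₁ ≤ ∫ s in (0 : ℝ)..Λ, (y s).2 ⟨0, Nat.succ_pos k⟩ ^ 2) :
    ∃ K₀ : ℝ, 1 ≤ K₀ ∧ ∀ K : ℝ, K₀ ≤ K → ∀ (x : PhaseSpace (k + 1 + n)),
      (cellChain ω₂ lam β γ (fun i => decide (i < k))).hamiltonian (k + 1 + n) x ≤ 2 * K ^ 4 →
      ∀ (η : ℝ → Fin (k + 1 + n) → ℝ) (T : ℝ), Continuous η →
      (∀ t ∈ Icc 0 T, ‖η t‖ ≤ δ₀ * K) → pinnedChainScaleA γ (k + 1 + n) * (δ₀ * K) * T ≤ K →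
      ∀ s₀ : ℝ, 0 ≤ s₀ → s₀ + Λ / K ≤ T →
      εc ≤ P₀⟦lam, β, k⟧.hamiltonian (k + 1) (prefixRungProj k (k + 1 + n) (Nat.le_add_right _ _)
        (rescale K (drivenFlow ((cellChain ω₂ lam β γ (fun i => decide (i < k))).langevinDrift (k + 1 + n)) x
          (fun s => ((0 : Fin (k + 1 + n) → ℝ), η s)) s₀))) →
      ε₁ / 16 * K ^ 3 ≤ ∫ t in s₀..s₀ + Λ / K,
        (drivenFlow ((cellChain ω₂ lam β γ (fun i => decide (i < k))).langevinDrift (k + 1 + n)) x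
            (fun s => ((0 : Fin (k + 1 + n) → ℝ), η s)) t - ((0 : Fin (k + 1 + n) → ℝ), η t)).2 ⟨0, by omega⟩ ^ 2 := by
  set N := k + 1 + n with hNdef
  set P := cellChain ω₂ lam β γ (fun i => decide (i < k)) with hP
  have hUC := cellChain_uniformlyConfining hω hl.le hβ.le hγ (fun i => decide (i < k))
  have hkN : k + 1 ≤ N := Nat.le_add_right _ _
  set c₁ := pinnedChainScaleC ω₂ lam β γ N with hc₁
  have hc₁0 : 0 ≤ c₁ := pinnedChainScaleC_nonneg hω.le hl.le hβ.le hγ N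
  set A := pinnedChainScaleA γ N with hA
  have hA1 : 1 ≤ A := one_le_pinnedChainScaleA hγ N
  -- the closeness theorem, with noise `2δ₀`, ceiling `c₁ + 1`, energy bound `c₁ + 1`
  obtain ⟨K₁, hK₁, hC⟩ := prefixRung_dissipation_ge_of_limit (lam := lam) (β := β) hω hl hβ hγ hk hkN
    (Λ := Λ) (δ₀ := 2 * δ₀) (c₁ := c₁ + 1) (h₀ := c₁ + 1) (ε₁ := ε₁) hΛ (by positivity) hε₁
  -- the thresholds
  set K₂ : ℝ := (N : ℝ) * (c₁ + 1) + 1 with hK₂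
  set K₃ : ℝ := 16 * Λ * δ₀ ^ 2 / ε₁ + 1 with hK₃
  set K₀ : ℝ := max (max K₁ K₂) K₃ with hK₀
  refine ⟨K₀, hK₁.trans ((le_max_left _ _).trans (le_max_left _ _)), ?_⟩
  intro K hK x hx η T hη hM hAMT s₀ hs₀ hsT hreg
  have hKK₁ : K₁ ≤ K := ((le_max_left _ _).trans (le_max_left _ _)).trans hK
  have hKK₂ : K₂ ≤ K := ((le_max_right _ _).trans (le_max_left _ _)).trans hK
  have hKK₃ : K₃ ≤ K := (le_max_right _ _).trans hK
  have hK1 : 1 ≤ K := hK₁.trans hKK₁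
  have hK0 : 0 < K := by linarith
  have hΛK : 0 < Λ / K := by positivity
  have hT0 : 0 ≤ T := by linarith [hΛK.le]
  -- the path and its smooth part
  set Y := P.langevinDrift N with hY
  set z : ℝ → PhaseSpace N := drivenFlow Y x (fun s => ((0 : Fin N → ℝ), η s)) with hz
  have hzc : Continuous z := hUC.continuous_drivenFlow N x hη
  have hzIE := hUC.isIntegralSolutionOn_drivenFlow N x hη T
  -- the ceiling and the momentum bounds along `[0, T]`
  have hbds := cellChain_smoothPart_bounds_of_ceiling hω hl.le hβ.le hγ (fun i => decide (i < k)) N hK1 hx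
    hzc hM hAMT hzIE
  have hceil : ∀ t ∈ Icc 0 T, P.hamiltonian N (z t - ((0 : Fin N → ℝ), η t)) ≤ c₁ * K ^ 4 :=
    cellChain_hamiltonian_smoothPart_le_ceiling hω hl.le hβ.le hγ (fun i => decide (i < k)) N hK1 hx hzc hM
      hAMT hzIE
  -- the restart at `s₀`
  set x' := z s₀ with hx'
  set η' : ℝ → Fin N → ℝ := fun r => η (s₀ + r) - η s₀ with hη'
  have hη'c : Continuous η' := (hη.comp (continuous_const.add continuous_id)).sub continuous_const
  set z' : ℝ → PhaseSpace N := drivenFlow Y x' (fun s => ((0 : Fin N → ℝ), η' s)) with hz'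
  have hcocycle : ∀ s, 0 ≤ s → z' s = z (s₀ + s) := by
    intro s hs
    have h := (hUC.confinedDrift N).toConfinedDrift.flow_add x (continuous_const.prodMk hη)
      (fun r => hUC.momentumNoise_mem_noise N (η r)) hs₀ hs
    rw [hz', hx', hz, hη']
    rw [h, restart_noise_eq]
  -- bounds on the restarted noise and ceiling for the restarted smooth part
  have hs₀T : s₀ ∈ Icc 0 T := ⟨hs₀, by linarith [hΛK.le]⟩
  have hM' : ∀ s ∈ Icc 0 (Λ / K), ‖η' s‖ ≤ 2 * δ₀ * K := by
    intro s hs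
    have h1 := hM (s₀ + s) ⟨by linarith [hs.1], by linarith [hs.2]⟩
    have h2 := hM s₀ hs₀T
    calc ‖η' s‖ = ‖η (s₀ + s) - η s₀‖ := rfl
      _ ≤ ‖η (s₀ + s)‖ + ‖η s₀‖ := norm_sub_le _ _
      _ ≤ δ₀ * K + δ₀ * K := add_le_add h1 h2
      _ = 2 * δ₀ * K := by ring
  -- the momentum shift `η(s₀)` costs at most `K⁴`
  have hηs₀ : ∀ i, |η s₀ i| ≤ δ₀ * K := fun i =>
    (Real.norm_eq_abs _ ▸ norm_le_pi_norm (η s₀) i).trans (hM s₀ hs₀T)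
  have hshift : ∀ t ∈ Icc 0 T, P.hamiltonian N (z t - ((0 : Fin N → ℝ), η t) + ((0 : Fin N → ℝ), η s₀)) ≤
      (c₁ + 1) * K ^ 4 := by
    intro t ht
    set y := z t - ((0 : Fin N → ℝ), η t) with hy
    have hmom := (hbds t ht).2
    have e : y + ((0 : Fin N → ℝ), η s₀) = (y.1, y.2 + η s₀) := by ext i <;> simp
    have hid := P.hamiltonian_momentum_shift N y.1 y.2 (η s₀)
    have hsum : ∑ i, (y.2 i * η s₀ i + η s₀ i ^ 2 / 2) ≤ N * ((c₁ + 1 / 2) * K ^ 2 * (δ₀ * K) + (δ₀ * K) ^ 2 / 2) := by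
      have h1 : ∀ i, y.2 i * η s₀ i + η s₀ i ^ 2 / 2 ≤ (c₁ + 1 / 2) * K ^ 2 * (δ₀ * K) + (δ₀ * K) ^ 2 / 2 := by
        intro i
        have ha := hmom i
        have hb := hηs₀ i
        have hab : y.2 i * η s₀ i ≤ (c₁ + 1 / 2) * K ^ 2 * (δ₀ * K) := by
          calc y.2 i * η s₀ i ≤ |y.2 i * η s₀ i| := le_abs_self _
            _ = |y.2 i| * |η s₀ i| := abs_mul _ _
            _ ≤ (c₁ + 1 / 2) * K ^ 2 * (δ₀ * K) := mul_le_mul ha hb (abs_nonneg _) (by positivity)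
        have hsq : η s₀ i ^ 2 ≤ (δ₀ * K) ^ 2 := by
          rw [← sq_abs]; exact pow_le_pow_left₀ (abs_nonneg _) hb 2
        linarith
      calc ∑ i, (y.2 i * η s₀ i + η s₀ i ^ 2 / 2) ≤ ∑ _i : Fin N, ((c₁ + 1 / 2) * K ^ 2 * (δ₀ * K) + (δ₀ * K) ^ 2 / 2) :=
            Finset.sum_le_sum fun i _ => h1 i
        _ = N * ((c₁ + 1 / 2) * K ^ 2 * (δ₀ * K) + (δ₀ * K) ^ 2 / 2) := by
            rw [Finset.sum_const, Finset.card_univ, Fintype.card_fin, nsmul_eq_mul]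
    have hsmall : (N : ℝ) * ((c₁ + 1 / 2) * K ^ 2 * (δ₀ * K) + (δ₀ * K) ^ 2 / 2) ≤ K ^ 4 := by
      -- `N((c₁+1/2)δ₀ + δ₀²/2) K³ ≤ N(c₁+1) K³ ≤ K⁴` since `δ₀ ≤ 1` and `K ≥ N(c₁+1)+1`
      have hN0 : (0 : ℝ) ≤ N := Nat.cast_nonneg N
      have h1 : (c₁ + 1 / 2) * K ^ 2 * (δ₀ * K) + (δ₀ * K) ^ 2 / 2 ≤ (c₁ + 1) * K ^ 3 := by
        have hK3 : 0 ≤ K ^ 3 := by positivity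
        have hδK : δ₀ * K ≤ K := by nlinarith
        nlinarith [mul_nonneg hc₁0 hK3, sq_nonneg K, mul_nonneg hδ₀.le hK0.le, sq_nonneg (δ₀ * K)]
      have h2 : (N : ℝ) * (c₁ + 1) ≤ K := by rw [hK₂] at hKK₂; linarith
      calc (N : ℝ) * ((c₁ + 1 / 2) * K ^ 2 * (δ₀ * K) + (δ₀ * K) ^ 2 / 2) ≤ N * ((c₁ + 1) * K ^ 3) :=
            mul_le_mul_of_nonneg_left h1 hN0
        _ = (N * (c₁ + 1)) * K ^ 3 := by ring
        _ ≤ K * K ^ 3 := mul_le_mul_of_nonneg_right h2 (by positivity)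
        _ = K ^ 4 := by ring
    have hyE : P.hamiltonian N y ≤ c₁ * K ^ 4 := hceil t ht
    have hyq : P.hamiltonian N (y.1, y.2) = P.hamiltonian N y := rfl
    rw [e]
    linarith [hid, hsum, hsmall, hyE, hyq]
  have hceil' : ∀ s ∈ Icc 0 (Λ / K), P.hamiltonian N (z' s - ((0 : Fin N → ℝ), η' s)) ≤ (c₁ + 1) * K ^ 4 := by
    intro s hs
    have ht : s₀ + s ∈ Icc 0 T := ⟨by linarith [hs.1], by linarith [hs.2]⟩
    have e : z' s - ((0 : Fin N → ℝ), η' s) = z (s₀ + s) - ((0 : Fin N → ℝ), η (s₀ + s)) + ((0 : Fin N → ℝ), η s₀) := by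
      rw [hcocycle s hs.1, hη']
      ext i
      · simp
      · simp only [Prod.snd_sub, Prod.snd_add, Pi.sub_apply, Pi.add_apply]; ring
    rw [e]; exact hshift (s₀ + s) ht
  -- the reference solution of the limit cell chain from the projected rescaled restart point
  set xh : PhaseSpace (k + 1) := prefixRungProj k N hkN (rescale K x') with hxh
  have hxhE : P₀⟦lam, β, k⟧.hamiltonian (k + 1) xh ≤ c₁ + 1 := by
    have h1 := prefixLimit_hamiltonian_proj_rescale_le (lam := lam) (β := β) (γ := γ) (k := k) (n := n)
      hω.le hK0.ne' hkN x'
    have h2 : P.hamiltonian N x' ≤ (c₁ + 1) * K ^ 4 := by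
      have e : x' = z s₀ - ((0 : Fin N → ℝ), η s₀) + ((0 : Fin N → ℝ), η s₀) := by rw [sub_add_cancel]
      rw [e]; exact hshift s₀ hs₀T
    have hK4 : 0 < K ^ 4 := by positivity
    calc P₀⟦lam, β, k⟧.hamiltonian (k + 1) xh ≤ (K ^ 4)⁻¹ * P.hamiltonian N x' := h1
      _ ≤ (K ^ 4)⁻¹ * ((c₁ + 1) * K ^ 4) := mul_le_mul_of_nonneg_left h2 (by positivity)
      _ = c₁ + 1 := by field_simp
  -- its Hamiltonian flow (frictionless, noiseless)
  have hU2 : ∀ i, ContDiff ℝ 2 (P₀⟦lam, β, k⟧.U i) := fun i => prefixLimit_contDiff_U lam β k i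
  have hV2 : ∀ i, ContDiff ℝ 2 (P₀⟦lam, β, k⟧.V i) := fun i => prefixLimit_contDiff_V lam β k i
  have hPU : ∀ (i : ℕ) (q : ℝ), P₀⟦lam, β, k⟧.U i q = (fun i : ℕ => if i < k then lam else 0) i * q ^ 4 / 4 :=
    fun i q => rfl
  have hPV : ∀ (i : ℕ) (r : ℝ), P₀⟦lam, β, k⟧.V i r = β * r ^ 4 / 4 := fun i r => rfl
  have ha : ∀ i : ℕ, 0 ≤ (fun i : ℕ => if i < k then lam else 0) i := fun i => by
    simp only; split_ifs <;> linarith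
  have ha0 : 0 < (fun i : ℕ => if i < k then lam else 0) 0 := by simp only; rw [if_pos hk]; exact hl
  set R : ℝ := (k + 1 : ℕ) * (1 + 4 * (c₁ + 1) / ((fun i : ℕ => if i < k then lam else 0) 0) + 4 * (c₁ + 1) / β) +
    (c₁ + 1) + 1 with hRdef
  have hR : 0 < R := by
    have h1 : 0 ≤ 4 * (c₁ + 1) / ((fun i : ℕ => if i < k then lam else 0) 0) := by positivity
    have h2 : 0 ≤ 4 * (c₁ + 1) / β := by positivity
    rw [hRdef]; positivity
  have hρ : ∀ w : PhaseSpace (k + 1), P₀⟦lam, β, k⟧.hamiltonian (k + 1) w ≤ c₁ + 1 → ‖w‖ ≤ R := fun w hw =>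
    SiteChain.quartic_norm_le_of_hamiltonian_le hPU hPV ha ha0 hβ (k + 1) hw
  set yh : ℝ → PhaseSpace (k + 1) := drivenTruncSol (SiteChain.langevinDrift P₀⟦lam, β, k⟧ (k + 1)) R xh 0 with hyh
  have hyhc : Continuous yh := SiteChain.continuous_truncFlow hU2 hV2 (k + 1) hR xh
  have hyh0 : yh 0 = xh := SiteChain.truncFlow_zero hU2 hV2 (k + 1) hR xh
  have hγ0 : P₀⟦lam, β, k⟧.γ = 0 := rfl
  have hyhd : ∀ σ ∈ Ioo 0 Λ, HasDerivAt yh (SiteChain.langevinDrift P₀⟦lam, β, k⟧ (k + 1) (yh σ)) σ :=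
    fun σ hσ => SiteChain.hasDerivAt_truncFlow_langevinDrift hU2 hV2 (k + 1) hR hγ0 hρ hxhE hσ.1
  have hyhE : ∀ σ ∈ Icc 0 Λ, P₀⟦lam, β, k⟧.hamiltonian (k + 1) (yh σ) ≤ c₁ + 1 := fun σ _ => by
    rw [hyh, SiteChain.hamiltonian_truncFlow hU2 hV2 (k + 1) hR hγ0]; exact hxhE
  have hdiss : ε₁ ≤ ∫ σ in (0 : ℝ)..Λ, (yh σ).2 ⟨0, Nat.succ_pos k⟩ ^ 2 :=
    hS5 xh yh hreg hxhE hyhc hyh0 hyhd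
  -- the closeness theorem on the restarted window
  have hmain := hC K hKK₁ x' η' hη'c hM' hceil' yh hyhc hyh0 hyhd hyhE hdiss
  -- transfer back: `z'(s) - (0, η'(s)) = y(s₀ + s) + (0, η(s₀))`
  set i0 : Fin N := ⟨0, by omega⟩ with hi0
  have hint_eq : ∫ s in (0 : ℝ)..Λ / K, (z' s - ((0 : Fin N → ℝ), η' s)).2 i0 ^ 2 =
      ∫ s in (0 : ℝ)..Λ / K, ((z (s₀ + s) - ((0 : Fin N → ℝ), η (s₀ + s))).2 i0 + η s₀ i0) ^ 2 := by
    refine intervalIntegral.integral_congr fun s hs => ?_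
    rw [uIcc_of_le hΛK.le] at hs
    show (z' s - ((0 : Fin N → ℝ), η' s)).2 i0 ^ 2 = ((z (s₀ + s) - ((0 : Fin N → ℝ), η (s₀ + s))).2 i0 + η s₀ i0) ^ 2
    rw [hcocycle s hs.1, hη']
    simp only [Prod.snd_sub, Pi.sub_apply]
    ring
  rw [hint_eq] at hmain
  -- `∫_{s₀}^{s₀+Λ/K} ȳ₀² = ∫₀^{Λ/K} ȳ₀(s₀+s)²`
  have hshiftInt : ∫ t in s₀..s₀ + Λ / K, (z t - ((0 : Fin N → ℝ), η t)).2 i0 ^ 2 =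
      ∫ s in (0 : ℝ)..Λ / K, (z (s₀ + s) - ((0 : Fin N → ℝ), η (s₀ + s))).2 i0 ^ 2 := by
    rw [intervalIntegral.integral_comp_add_left (fun t => (z t - ((0 : Fin N → ℝ), η t)).2 i0 ^ 2) s₀]
    simp
  rw [hshiftInt]
  -- pointwise `(a+e)² ≤ 2a² + 2e²`, integrate
  set a : ℝ → ℝ := fun s => (z (s₀ + s) - ((0 : Fin N → ℝ), η (s₀ + s))).2 i0 with ha'
  set e : ℝ := η s₀ i0 with he
  have hyc : Continuous a :=
    (continuous_apply i0).comp (continuous_snd.comp ((hzc.comp (continuous_const.add continuous_id)).sub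
      (continuous_const.prodMk (hη.comp (continuous_const.add continuous_id)))))
  have hI : ∫ s in (0 : ℝ)..Λ / K, (a s + e) ^ 2 ≤ ∫ s in (0 : ℝ)..Λ / K, (2 * a s ^ 2 + 2 * e ^ 2) :=
    intervalIntegral.integral_mono_on hΛK.le (((hyc.add continuous_const).pow 2).intervalIntegrable _ _)
      ((((hyc.pow 2).const_mul 2).add continuous_const).intervalIntegrable _ _)
      fun s _ => by nlinarith [sq_nonneg (a s - e)]
  have hA' : ∫ s in (0 : ℝ)..Λ / K, (2 * a s ^ 2 + 2 * e ^ 2) =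
      (∫ s in (0 : ℝ)..Λ / K, 2 * a s ^ 2) + ∫ _s in (0 : ℝ)..Λ / K, 2 * e ^ 2 :=
    intervalIntegral.integral_add (((hyc.pow 2).const_mul 2).intervalIntegrable _ _)
      (continuous_const.intervalIntegrable _ _)
  have hB' : ∫ s in (0 : ℝ)..Λ / K, 2 * a s ^ 2 = 2 * ∫ s in (0 : ℝ)..Λ / K, a s ^ 2 :=
    intervalIntegral.integral_const_mul 2 _
  have hC' : ∫ _s in (0 : ℝ)..Λ / K, 2 * e ^ 2 = (Λ / K) * (2 * e ^ 2) := by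
    rw [intervalIntegral.integral_const, sub_zero, smul_eq_mul]
  have hsplit : ∫ s in (0 : ℝ)..Λ / K, (2 * a s ^ 2 + 2 * e ^ 2) =
      2 * (∫ s in (0 : ℝ)..Λ / K, a s ^ 2) + (Λ / K) * (2 * e ^ 2) := by
    rw [hA', hB', hC']
  have h2 : Λ / K * e ^ 2 ≤ ε₁ / 16 * K ^ 3 := by
    have hb := hηs₀ i0
    have hsq : e ^ 2 ≤ (δ₀ * K) ^ 2 := by rw [he, ← sq_abs]; exact pow_le_pow_left₀ (abs_nonneg _) hb 2
    have h3 : 16 * Λ * δ₀ ^ 2 / ε₁ ≤ K := by rw [hK₃] at hKK₃; linarith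
    have h4 : 16 * Λ * δ₀ ^ 2 ≤ ε₁ * K := by
      have := mul_le_mul_of_nonneg_left h3 hε₁.le
      rwa [mul_div_cancel₀ _ hε₁.ne'] at this
    calc Λ / K * e ^ 2 ≤ Λ / K * (δ₀ * K) ^ 2 := mul_le_mul_of_nonneg_left hsq hΛK.le
      _ = Λ * δ₀ ^ 2 * K := by field_simp
      _ ≤ ε₁ / 16 * K * K := by nlinarith
      _ ≤ ε₁ / 16 * K ^ 3 := by
          have : K * K ≤ K ^ 3 := by nlinarith
          nlinarith [hε₁.le]
  have hmain' : ε₁ / 4 * K ^ 3 ≤ ∫ s in (0 : ℝ)..Λ / K, (a s + e) ^ 2 := hmain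
  rw [hsplit] at hI
  show ε₁ / 16 * K ^ 3 ≤ ∫ s in (0 : ℝ)..Λ / K, a s ^ 2
  linarith [hmain', hI, h2]

end CellGain

end Literature.MathematicalPhysics.KineticTheory.HeatConduction
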